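import Mathlib
import HarnessLib
import HarnessLib.Audit
import Summits.KontsevichZagierPeriods.Statement
import Literature.NumberTheory.Transcendental.MZVSimplexRep
import HarnessLib.Audit.Status.Attr

/-!
Route: HodgeColevel

DORMANT since 2026-08-25T10:50:30Z (reconciler: no traction for 7.6 d (last activity item-evidence-added at 2026-08-17T19:12:22Z); parked, not closed — `ledger route dormant route-KontsevichZagierPeriods-HodgeColevel --off` to reactivat) — unstaffed, not closed; items shared with open routes are served there. `ledger route dormant <id> --off` reactivates.

# Route HodgeColevel — a period needs as many variables as the Hodge co-level of its motive —
Conjecture 1 split into compression and same-degree halves, weight/type lower bounds as the engine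

It suffices to show X = DegreeCompression ∧ SameDegreeConjecture: Conjecture 1 refactored along the
KZ-DEGREE deg_KZ(r) := least
dimension of a representation KZ-equivalent to r (Kontsevich–Zagier's Problem 2, "the simplest
representation"; card
kz-degree-hodge-colevel-problem-two). DegreeCompression (open core 1): two rational representations
with the same value reach the
same dimensions by moves (equal values ⇒ equal KZ-degree). SameDegreeConjecture (open core 2): two
incompressible representations of
one dimension with the same value are KZ-equivalent. The card is the ENGINE that computes the
strata: DegreeBound — deg_KZ(r) ≥ Hodge
co-level of the Nori symbol of r, because moves are motivic and an m-dimensional representation is a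
period of H^m of an m-dimensional
pair (weights ≤ 2m, Hodge types in the box [0,m]²) — with typed instances PiPowDegree (π^n needs n
variables, rank 2) and MZVWeightDegree
(a multiple zeta value of weight w needs w variables, rank 3), supports PiSquaredDegree,
EllipticSquareDegree (Hodge TYPE finer than
weight), PiPowNotConstant (provable now), and the conjectural converse DegreeEquality (deg_KZ =
co-level). Both cores follow from the
summit (support CoresOfSummit, provable now), so X ⟺ Conjecture 1; the line adds the stratification
by one integer, the instrument that
places a pair in it, and the first rung SameDegreeOne (d = 1, Huber–Wüstholz sector).
Lean: `(∀ ⦃n m : ℕ⦄ (r : Literature.NumberTheory.Transcendental.KZ.IntegralRep n) (r' :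
Literature.NumberTheory.Transcendental.KZ.IntegralRep m), r.IsRational → r'.IsRational → r.value =
r'.value → ∀ (k : ℕ), (∃ s : Literature.NumberTheory.Transcendental.KZ.IntegralRep k,
Literature.NumberTheory.Transcendental.KZ.Equivalent r s) → ∃ s' :
Literature.NumberTheory.Transcendental.KZ.IntegralRep k,
Literature.NumberTheory.Transcendental.KZ.Equivalent r' s') ∧ (∀ (d : ℕ) (r r' :
Literature.NumberTheory.Transcendental.KZ.IntegralRep d), (∀ k < d, ∀ s :
Literature.NumberTheory.Transcendental.KZ.IntegralRep k, ¬
Literature.NumberTheory.Transcendental.KZ.Equivalent r s) → (∀ k < d, ∀ s :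
Literature.NumberTheory.Transcendental.KZ.IntegralRep k, ¬
Literature.NumberTheory.Transcendental.KZ.Equivalent r' s) → r.value = r'.value →
Literature.NumberTheory.Transcendental.KZ.Equivalent r r')`

## Assembly
Pure logic plus soundness, proved sorry-free in the planner's Sketch.lean (25 lines): given rational
r, r′ with equal values, let
d := Nat.find of the reachable dimensions of r and s : IntegralRep d with r ~ s (exists: r ~ r);
DegreeCompression in both directions
makes d minimal for r′ too and gives s′ : IntegralRep d with r′ ~ s′; s and s′ are incompressible by
minimality and transitivity,
have equal values by KZ.Equivalent.value_eq_holds, so SameDegreeConjecture gives s ~ s′ and r ~ s ~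
s′ ~ r′. The summit constant
unfolds to Literature.Periods.KZPeriodConjecture by `show`.

Rationale: WHY THIS LINE. Kontsevich–Zagier's Problem 2 asks for the simplest representation of a period; the
only printed degree theory (Wan2011, Def. 3.1,
volume normalisation: deg π = deg log n = 2, "give a concrete period of degree ≥ 3" posed as open
Problem 1) is VALUE-level and has no
lower-bound technology beyond "algebraic ⇔ degree ≤ 1". Inside the rules lower bounds become
provable: compose Ψ ("moves are motivic":
KZ.relations map to 0 in the formal period space of Nori motives, HuberMullerStachPeriods2017 §13.1,
the easy direction of the comparison
that route NoriTransfer needs the other way) with two theorems of mixed Hodge theory — an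
m-dimensional representation is a period of
H^m(X,D), dim X = m (HuberMullerStachPeriods2017 Thm 12.2.1), whose weights lie in [0,2m] and Hodge
types in [0,m]² (DeligneHodgeIII1974),
and morphisms of Nori motives are strict for W and F, so membership of a formal period in the span
of coefficient spaces of small-box
motives is read on the comodule it generates (Jordan–Hölder; weight grading on the pure part via
Arapura2013 / Andre1996). This is the
move-invariant-functional shape that Literature.Barriers.KontsevichZagierPeriods
(GrothendieckPeriodConjectureDependence, "stage 1")
says any use of Conjecture 1 towards transcendence must construct, pointed at DIMENSION instead of
at values: π^n gets KZ-degree n,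
ζ(s) gets |s| (Brown2012 / BrownMTM2012 weight grading of motivic MZVs, DeligneGoncharov2005), Wan's
Problem 1 is solved in its
proof-theoretic form, and Conjecture 1 splits into a compression half (where Hodge effectivity,
Grothendieck1969-type, makes the
predictions) and a same-degree half graded by one integer d whose d = 1 rung is the Huber–Wüstholz
theorem sector (HuberWustholz2022
Thm 13.3 / 9.10). Imported: mixed Hodge theory of Nori motives and Tannakian coalgebra bookkeeping
(algebraic geometry), motivic MZVs
(arithmetic); no analytic or probabilistic reformulation is used — the point of the line is that no
period is ever evaluated.

RANKED CRUXES. #0 Target (target) — X = DegreeCompression ∧ SameDegreeConjecture as in § Thesis.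
(why it might fail: X ⟺ Conjecture 1 (CoresOfSummit + Assembly): every strength barrier of the
summit applies to X as a whole; the split only relocates difficulty by the pair's degrees.)
[KontsevichZagierPeriods2001, Wan2011, HuberMullerStachPeriods2017]
#2 PiPowDegree (crux) — π^n needs n variables inside the rules (card item PiPowDegree): for every n,
the representation [ (0,1)^n, ∏ᵢ 4/(1+xᵢ²) ] (value π^n) is not KZ-equivalent to any integral
representation of dimension m < n. Route to a proof: Ψ (moves are motivic) sends an m-dimensional
rep into W_{2m} of the formal period space; the cube symbol is the n-th power of a symbol of weight
exactly 2 (π transcendental forces weight 2, not 0), hence of weight exactly 2n by the weight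
grading of the mixed (Artin–)Tate formal periods over ℚ(i); 2n > 2m. [difficulty: XL] (why it might
fail: Rides on Ψ (every H21 move instance, incl. rule (3) with merely fibrewise-continuous
semialgebraic primitives, is a formal-period relator — unbuilt) and on multiplicativity of Ψ on
product reps for top-weight 2n survival; a compressing chain would refute Kontsevich's FORMAL period
conjecture.) [KontsevichZagierPeriods2001, Wan2011, HuberMullerStachPeriods2017,
DeligneHodgeIII1974, DeligneGoncharov2005]
#3 MZVWeightDegree (crux) — a multiple zeta value of weight w needs w variables inside the rules
(card item MZVDegree): for every admissible index s, the simplex representation KZ.mzvRep s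
(dimension = MZV.weight s) is not KZ-equivalent to any representation of smaller dimension. Route:
Ψ[mzvRep s] is the image of Brown's motivic ζ^𝔪(s), homogeneous of weight |s| (Hodge–Tate weight
2|s|) and non-zero (its period is > 0); the weight-2w constituent survives in the Nori comodule it
generates (G_Nori ↠ 𝔾_m through mixed Tate), while an m-dimensional rep lands in W_{2m}. [deps:
PiPowDegree] [difficulty: XL] (why it might fail: Mixed symbol: needs Ψ plus the identification of
Ψ[simplex rep] with Brown's ζ^𝔪(s) (Goncharov–Manin motive of the moduli-space pair) and survival of
the weight-2w constituent along MT(ℚ) → Nori motives; a gap there leaves only the pure PiPow-type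
cases.) [Brown2012, BrownMTM2012, DeligneGoncharov2005, Goncharov2005, HuberMullerStachPeriods2017]
#4 DegreeCompression (crux) — OPEN CORE 1 (compression half of Conjecture 1): if two rational
integral representations have the same value, every dimension reachable by moves from one is
reachable from the other — equal values ⇒ equal KZ-degree; in particular every rational
representation of a number that has a k-dimensional representation compresses to k variables. Under
DegreeBound + DegreeEquality it reads "equal values ⇒ equal Hodge co-level", a one-integer shadow of
the formal period conjecture. [difficulty: open-problem] (why it might fail: Summit-strength: with
PiPowDegree it yields "π² is not the value of a rational 1-dim representation" (open transcendence),
and its k = 0 layer says every rational rep with an algebraic value moves to a point — accessibility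
no engine here proves.) [KontsevichZagierPeriods2001, Wan2011, HuberWustholz2022,
HuberMullerStachPeriods2017]
#5 SameDegreeConjecture (crux) — OPEN CORE 2 (same-degree half of Conjecture 1): two integral
representations of the same dimension d, both incompressible (not KZ-equivalent to any
representation of dimension < d), with the same value, are KZ-equivalent. Graded by one integer: d =
1 is SameDegreeOne (support; Huber–Wüstholz sector), d = 2 already contains Euler's ζ(2) = π²/6,
Catalan-type and elliptic area identities, d = w the weight-w MZV relations. DegreeBound instances
certify the incompressibility hypotheses of concrete pairs. [difficulty: open-problem] (why it might
fail: Summit-strength: at d = w it contains all weight-w MZV identities with regularised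
intermediates and the Γ-detour identities (route Neg pressure points (a),(b)); a non-equivalent
incompressible pair of equal value refutes it and the summit together.)
[KontsevichZagierPeriods2001, HuberMullerStachPeriods2017, CressonViusos2022, HuberWustholz2022]
#9 PiSquaredDegree (support) — π² needs two variables (n = 2 of PiPowDegree, the crisp first Lean
target of the engine): the representation [ (0,1)², 16/((1+x²)(1+y²)) ] is not KZ-equivalent to any
1-dimensional integral representation. Consistent with Wan2011 Ex. 3.3(2) (π² as a 2-dim rep with
rational integrand over the disc) and with Euler ζ(2) = π²/6 (both sides of degree 2). [difficulty:
L] [KontsevichZagierPeriods2001, Wan2011, HuberMullerStachPeriods2017]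
#9 PiPowNotConstant (support) — provable now (calibration of the 0-dimensional API and the m = 0
slice of PiPowDegree): for n ≥ 1 the cube representation of π^n is not KZ-equivalent to any
0-dimensional representation — soundness KZ.Equivalent.value_eq_holds, the value of a 0-dim rep is a
real algebraic number (a ℚ-semialgebraic point of ℝ), Fubini + ∫₀¹ 4/(1+x²) = π, and Lindemann
(Literature.NumberTheory.Transcendental.transcendental_pi_holds). [difficulty: provable-now]
[KontsevichZagierPeriods2001, Lindemann1882]
#9 EllipticSquareDegree (support) — Hodge TYPE is finer than weight (card's F-separator, on a PURE
symbol with no support subtlety): the square of the real period ∫₁^∞ dx/√(x³−x) of y² = x³ − x,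
written as the 2-dim representation [ (1,∞)², 1/√((x³−x)(y³−y)) ], is not KZ-equivalent to any
1-dimensional representation — its symbol is the square of a weight-1 symbol (the relative part
vanishes by the [−1]-symmetry), of Hodge type (2,0)+…, outside the box [0,1]² of curve pairs,
although its weight 2 alone would allow one variable. [difficulty: XL] [HuberMullerStachPeriods2017,
Andre2004, HuberWustholz2022, DeligneHodgeII1971]
#9 SameDegreeOne (support) — the first rung of SameDegreeConjecture (d = 1): two 1-dimensional
integral representations, neither KZ-equivalent to a constant, with the same value are
KZ-equivalent. Values of 1-dim semialgebraic reps are cohomological 1-periods (curves relative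
points); HuberWustholz2022 Thm 13.3 (Kontsevich's period conjecture for 𝒫¹: all ℚ̄-linear relations
are induced by bilinearity and functoriality of curve pairs) plus a dimension-1 transfer of
functoriality along finite maps of curves into moves (monotone branches = changes of variables;
several sheets = route MultivaluedCoV's SheetTransfer at n = 1). Complements route LowDimension
(rational reps, Baker) on semialgebraic reps. [difficulty: XL] [HuberWustholz2022,
KontsevichZagierPeriods2001, Baker1975]
#9 CoresOfSummit (support) — honesty certificate, provable now (proved in the planner's
Sketch.lean): the summit implies both open cores — DegreeCompression by symmetry/transitivity of
KZ.Equivalent, SameDegreeConjecture via the semialgebraic two-representation form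
(Literature.NumberTheory.Transcendental.kzPeriodConjecture'_iff_isRational). Hence a refutation of
either core refutes Conjecture 1 (hand the witness to route Neg). [difficulty: provable-now]
[KontsevichZagierPeriods2001]

TWO-LAYER PLAN. Foreseen glued splits (none filed now): PiPowDegree ⇐ MovesAreMotivic (Ψ:
KZ.FormalRep →+ formal periods, kills KZ.relations,
m-dim reps land in W_{2m}) → CubeTopWeight (Ψ[cube_n] has weight exactly 2n) → PiPowDegree;
SameDegreeConjecture ⇐ SameDegreeOne →
SameDegreeTwoUp → SameDegreeConjecture (split by d, k = 2); DegreeCompression ⇐ DegreeEquality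
(deg_KZ = co-level, informal crux) →
ValueDeterminesColevel → DegreeCompression. Informal cruxes DegreeBound (rank 6, the general schema)
and DegreeEquality (rank 7, the
converse conjecture) are filed right after open with `workitem add --informal`, together with three
definition requests.

KILL CRITERIA. An explicit chain compressing the π²-cube (¬PiSquaredDegree), any π^n cube or a
weight-w MZV simplex below the predicted dimension
closes the route `refuted:<Decl>` AND is major news: given the Hodge-theoretic weight computation it
exhibits an H21 move that is not a
formal-period relator, i.e. a counterexample to Kontsevich's FORMAL period conjecture — report to
the operator and to routes
NoriTransfer/Grothendieck. A refutation of DegreeCompression or SameDegreeConjecture refutes the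
summit (CoresOfSummit): close
`refuted:<Decl>`, hand the pair to route Neg. If Ψ is shown impossible for the fixed rules (some
rule-(3) instance provably outside
the formal relations) the engine dies and the route pivots to the cores only (then it merely
restates the summit: close superseded by
LowDimension). LowDimension's LowdimBaker0DimLeOne proved ⇒ SameDegreeOne for rational reps is
mooted (semialgebraic part remains).

NOT DECOMPOSED YET. The construction of Ψ (definition request; it is NoriTransfer's transfer in the
opposite, easy direction and shares its
ClassicalPeriodDatum request), the weight / co-level filtration on the formal period space
(definition request), and the general
schema DegreeBound with its converse DegreeEquality (informal cruxes) are deliberately not split.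
The K3 test of the F-separator
(∫∫_{(0,1)²} dxdy/√(1+x⁶+y⁶) needs two variables) stays in Sketch.lean unfiled: for a RELATIVE
symbol the transcendental constituent
T(S) may be absorbed by the largest γ-null submotive — a support computation, layer 2. Compression
instances of DegreeEquality
(Legendre's relation as compression of a co-level-1 difference of 2-dim reps to one variable = route
Grothendieck's
GpcLegendreLemniscatic; triplication 0312, 2 → 1) belong to those routes. Wan's volume normalisation
(deg_Wan = deg + 1) is bookkeeping.

CHEAPEST FALSIFIER. (i) The coalgebra bookkeeping for a MIXED symbol, flagged by the card: does the
comodule generated by ζ^𝔪(3) keep weight 6? Done on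
paper here: Δζ^𝔪(3) = ζ^𝔪(3)⊗1 + 1⊗ζ^𝔪(3), the de Rham comodule is span{1, ζ^𝔪(3)}, its only proper
subcomodule is span{1}, the
quotient carries t³ — passes. (ii) A TRUE identity dropping dimension below the predicted co-level
would kill the engine on the spot;
checked on paper against the tree's calibration pairs: Wan2011 Ex. 3.3 (π log 2 and π² as 3-dim
volumes = 2-dim reps: co-levels 2, 2 ✓),
Euler ζ(2) = π²/6 (2 = 2 ✓), triplication pair 0312 B(1/9,4/9)B(5/9,7/9) = 2·3^{7/6}π (product
symbol of Hodge type (1,0)⊗(0,1) =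
Tate(−1)⊗Artin by Deligne's Γ-criterion: co-level 1 = 1 ✓ — the check the invariant could have
failed), Legendre (∧²H¹ = ℚ(−1): 1 = 1 ✓).
(iii) Not run (no kit in this seat): a table (predicted co-level, least known rep dimension) over
the period-atlas constants; any
entry with known dimension < predicted co-level retires the card.

NUMBERS. Wan2011 §3 (volume normalisation = ours + 1): deg 0 = 0, deg(algebraic ≠ 0) = 1, deg π =
deg log n = 2; Problem 1 (exhibit degree ≥ 3)
open at value level; Thm 5.1/5.2: different degrees ⇒ ℚ̄-linear independence. Predicted KZ-degrees
(this route): π^n ↦ n, ζ(s) ↦ |s|,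
log α, π, elliptic and abelian 1-periods ↦ 1, (real elliptic period)² ↦ 2, K3 transcendental period
in 2 variables ↦ 2, generic
product of k beta values ↦ k but Deligne-type Γ-monomials drop to their twist level (0312: 2 ↦ 1).
Weights of H^m of an m-dim pair:
[0, 2m]; Hodge types: [0, m]². Items at open: 11 (target, assembly, 4 typed cruxes, 5 supports) + 2
informal cruxes + 3 definition
requests filed after open.

DEFINITION REQUESTS. D1 `KZ.degree` (Literature/NumberTheory/Transcendental, addendum to KZCalculus;
definable now): `Nat.find` of {k | ∃ s : IntegralRep k,
Equivalent r s} with API degree_le_dim, exists_rep_of_degree, incompressible_at_degree,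
degree_eq_of_equivalent. D2 `KZ.noriSymbol`
(Ψ, "moves are motivic"): an additive map KZ.FormalRep →+ (formal period space of the classical Nori
datum) vanishing on KZ.relations,
compatible with evaluation, sending an m-dim rep into the coefficient space of H^m of an
m-dimensional pair — a theorem-level definition
(HuberMullerStachPeriods2017 §12.2, §13.1); shares NoriTransfer's ClassicalPeriodDatum request. D3
`HodgeColevelFiltration` on formal
periods: C_k := Σ{C(V) : all Hodge types (p,q) of V have max(p,q) ≤ k}, W_k likewise, and the
co-level / weight of an element. Cite
facts wanted: HMS Thm 12.2.1 (naive periods of dimension m are periods of H^m of m-dim pairs);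
Deligne Hodge III weight and type bounds
for H^m(X,D); Arapura2013 (pure Nori motives = André motives ⇒ weight grading on the pure part);
Brown2012 Thm 1.1 with the weight
grading of motivic MZVs; HuberWustholz2022 Thm 13.3.

Novelty: Searches (2026-08-15): `lit read arxiv:1102.2273 --grep degree` (Wan2011 materialised, pp. 6–8 READ:
Def. 3.1, Props. 3.2/3.4,
Ex. 3.3, Problems 1–3, Thms 5.1–5.2); `lit frontier KontsevichZagierPeriods --since 2020` (30 rows;
nearest arXiv:2303.05030 GPC for CM
Kummer surfaces, arXiv:2302.07650 arithmetic of periods of rational forms — none on representative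
dimension); `lit bridges
KontsevichZagierPeriods --cross any` (0 rows); `lit search --source zbmath "Kontsevich Zagier period
degree dimension representation"`
(2: ViuSos2021 = arXiv:1509.01097, Breiding–Kohn–Sturmfels 2024 irrelevant); `lit search --source
crossref "weight filtration period
conjecture Kontsevich Zagier dimension of domain"` (6: Viu-Sos thesis "Periods and line
arrangements", Ayoub2015, Ayoub 2019 Tohoku,
KontsevichZagierPeriods2001, HuberMullerStachPeriods2017 ch. 12, Costin–Garoufalidis irrelevant);
`lit read
book:huber2022-transcendence-linear-relations-1-periods --grep …` (Thm 1.2/13.3, 9.7, 9.10 located;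
no statement that π² or ζ(3) is not
a 1-period); local `lit search` daemon reset and `lit galaxy search "Degrees of periods" --star all`
saturated (queued > 90 s) at
11:30–11:50Z, arXiv/OpenAlex/S2 HTTP 429 — recorded in NOTES.md; the card's refuter audit
(arXiv:1509.01097 p. 3 read) stands in for
the local index. In-hub: the 12 Theses of the sub read (none bounds representative dimension),
barrier file
GrothendieckPeriodConjectureDependenceEllipticProofs (`not_kz_of_moveInvariant_separating`: move-  [refs: 10.1142/s179304212150007x:, 1102.2273, 2303.05030, 2302.07650, 1509.01097, arxiv:1102.2273, book:huber2022-transcendence-linear-relations-1-periods, doi:10.1142/s179304212150007x, Wan2011, ViuSos2021, Ayoub2015, KontsevichZagierPeriods2001, HuberMullerStachPeriods2017, DeligneHodgeIII1974, HuberWustholz2022]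

Barriers (technique_class: motivic-separator hodge-colevel representative-dimension): - technique_class: motivic-separator hodge-colevel representative-dimension
- Literature.Barriers.KontsevichZagierPeriods.kzConjecture_implies_oddZetaAlgIndep: conceded for the
cores (X ⟺ Conjecture 1; SameDegreeConjecture at d = w carries the odd-zeta consequences); evaded by
the engine: PiPowDegree, MZVWeightDegree, EllipticSquareDegree are non-existence-of-chains
statements proved from Hodge data — no value is separated, no independence asserted, deg_val claims
stay conditional on Conjecture 1.
- Literature.Barriers.KontsevichZagierPeriods.kzConjecture_implies_twoPiI_log_algIndep: conceded
likewise; recorded explicitly that DegreeCompression ∧ PiPowDegree ⊢ "π² is not the value of a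
rational 1-dim representation", so core 1 is at least that strong.
- Literature.Barriers.KontsevichZagierPeriods.kzConjecture_implies_ellipticPeriods_algIndep:
conceded for the cores; the barrier file's own analysis ("stage 1: construct move-invariant
functionals — none available without the motivic theory") is exactly the cost this route pays once
(Ψ), after which the functionals are aimed at dimension, where they prove theorems instead of
requiring transcendence.
- Literature.Barriers.KontsevichZagierPeriods.noSemialgebraicPrimitive_inv_sub_two: orthogonal — it
bounds the EXCURSION of chains (a primitive needs more variables), DegreeBound bounds the dimension
of ENDPOINTS and never asks for a primitive; neither implies the other.
- Literature.Barriers.KontsevichZagierPeriods.cressonViuSos_pro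

History (route lifecycle, newest last):
- 2026-08-16T02:18:11Z · AUTO-CRUX: 3 conjecture-grade item(s) promoted to crux (Target, SameDegreeOne, DegreeEquality) — refuter vetting / tiering apply (operator:999:1362873)
- 2026-08-25T10:50:30Z · DORMANT — reconciler: no traction for 7.6 d (last activity item-evidence-added at 2026-08-17T19:12:22Z); parked, not closed — `ledger route dormant route-KontsevichZagier (operator:999:1724300)

sub-problem: KontsevichZagierPeriods · status: dormant · opened planner-plancard-KontsevichZagierPeriods-Kont-bf0d47ff-0 2026-08-15T11:44:53Z · rev 2 · ledger route-KontsevichZagierPeriods-HodgeColevel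
GENERATED by the gate from the ledger (D-0016/17). Provers cite these decls: `theorem foo : Summit.KontsevichZagierPeriods.KontsevichZagierPeriods.Theses.HodgeColevel.<Decl> := …` in Summits/KontsevichZagierPeriods/KontsevichZagierPeriods/Theorems/<Name>.lean.
-/

namespace Summit.KontsevichZagierPeriods.KontsevichZagierPeriods.Theses.HodgeColevel

open scoped BigOperators Topology Manifold Classical MeasureTheory ProbabilityTheory Matrix InnerProductSpace ComplexConjugate ContinuousMap
open Filter Set Function TopologicalSpace MeasureTheory

attribute [summit_statement] _root_.KontsevichZagierPeriods

open Literature Periods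

/-- item stmt-KontsevichZagierPeriods-6174 · target · rank 0 · open · by planner
why it might fail: X ⟺ Conjecture 1 (CoresOfSummit + Assembly): every strength barrier of the summit applies to X as a whole; the split only relocates difficulty by the pair's degrees.
sources: KontsevichZagierPeriods2001, Wan2011, HuberMullerStachPeriods2017
[target] X = DegreeCompression ∧ SameDegreeConjecture as in § Thesis. -/
@[route_item "route-KontsevichZagierPeriods-HodgeColevel"]
def Target : Prop :=
  (∀ ⦃n m : ℕ⦄ (r : Literature.NumberTheory.Transcendental.KZ.IntegralRep n) (r' : Literature.NumberTheory.Transcendental.KZ.IntegralRep m), r.IsRational → r'.IsRational → r.value = r'.value → ∀ (k : ℕ), (∃ s : Literature.NumberTheory.Transcendental.KZ.IntegralRep k, Literature.NumberTheory.Transcendental.KZ.Equivalent r s) → ∃ s' : Literature.NumberTheory.Transcendental.KZ.IntegralRep k, Literature.NumberTheory.Transcendental.KZ.Equivalent r' s') ∧ (∀ (d : ℕ) (r r' : Literature.NumberTheory.Transcendental.KZ.IntegralRep d), (∀ k < d, ∀ s : Literature.NumberTheory.Transcendental.KZ.IntegralRep k, ¬ Literature.NumberTheory.Transcendental.KZ.Equivalent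 r s) → (∀ k < d, ∀ s : Literature.NumberTheory.Transcendental.KZ.IntegralRep k, ¬ Literature.NumberTheory.Transcendental.KZ.Equivalent r' s) → r.value = r'.value → Literature.NumberTheory.Transcendental.KZ.Equivalent r r')

/-- item stmt-KontsevichZagierPeriods-6175 · crux · rank 2 · open · by planner
why it might fail: Rides on Ψ (every H21 move instance, incl. rule (3) with merely fibrewise-continuous semialgebraic primitives, is a formal-period relator — unbuilt) and on multiplicativity of Ψ on product reps for top-weight 2n survival; a compressing chain would refute Kontsevich's FORMAL period conjecture.
sources: KontsevichZagierPeriods2001, Wan2011, HuberMullerStachPeriods2017, DeligneHodgeIII1974, DeligneGoncharov2005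
[crux] π^n needs n variables inside the rules (card item PiPowDegree): for every n, the
representation [ (0,1)^n, ∏ᵢ 4/(1+xᵢ²) ] (value π^n) is not KZ-equivalent to any integral
representation of dimension m < n. Route to a proof: Ψ (moves are motivic) sends an m-dimensional
rep into W_{2m} of the formal period space; the cube symbol is the n-th power of a symbol of weight
exactly 2 (π transcendental forces weight 2, not 0), hence of weight exactly 2n by the weight
grading of the mixed (Artin–)Tate formal periods over ℚ(i); 2n > 2m. [difficulty: XL] -/
@[route_item "route-KontsevichZagierPeriods-HodgeColevel"]
def PiPowDegree : Prop :=
  ∀ (n : ℕ) (r : Literature.NumberTheory.Transcendental.KZ.IntegralRep n), r.domain = {z | ∀ i, z i ∈ Set.Ioo (0:ℝ) 1} → Set.EqOn r.integrand (fun z => ∏ i, 4 / (1 + z i ^ 2)) r.domain → ∀ (m : ℕ), m < n → ∀ (r' : Literature.NumberTheory.Transcendental.KZ.IntegralRep m), ¬ Literature.NumberTheory.Transcendental.KZ.Equivalent r r'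

/-- item stmt-KontsevichZagierPeriods-6176 · crux · rank 3 · open · by planner
why it might fail: Mixed symbol: needs Ψ plus the identification of Ψ[simplex rep] with Brown's ζ^𝔪(s) (Goncharov–Manin motive of the moduli-space pair) and survival of the weight-2w constituent along MT(ℚ) → Nori motives; a gap there leaves only the pure PiPow-type cases.
sources: Brown2012, BrownMTM2012, DeligneGoncharov2005, Goncharov2005, HuberMullerStachPeriods2017
[crux] a multiple zeta value of weight w needs w variables inside the rules (card item MZVDegree):
for every admissible index s, the simplex representation KZ.mzvRep s (dimension = MZV.weight s) is
not KZ-equivalent to any representation of smaller dimension. Route: Ψ[mzvRep s] is the image of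
Brown's motivic ζ^𝔪(s), homogeneous of weight |s| (Hodge–Tate weight 2|s|) and non-zero (its period
is > 0); the weight-2w constituent survives in the Nori comodule it generates (G_Nori ↠ 𝔾_m through
mixed Tate), while an m-dimensional rep lands in W_{2m}. [deps: PiPowDegree] [difficulty: XL] -/
@[route_item "route-KontsevichZagierPeriods-HodgeColevel"]
def MZVWeightDegree : Prop :=
  ∀ (s : List ℕ) (hs : Literature.NumberTheory.Transcendental.MZV.IsAdmissible s) (m : ℕ), m < Literature.NumberTheory.Transcendental.MZV.weight s → ∀ (r' : Literature.NumberTheory.Transcendental.KZ.IntegralRep m), ¬ Literature.NumberTheory.Transcendental.KZ.Equivalent (Literature.NumberTheory.Transcendental.KZ.mzvRep s hs (Literature.NumberTheory.Transcendental.KZ.mzvIntegrand_isSemialgebraicFunOn_holds s) (Literature.NumberTheory.Transcendental.KZ.mzvIntegrand_integrableOn_holds s hs)) r'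

/-- item stmt-KontsevichZagierPeriods-6177 · crux · rank 4 · open · by planner
why it might fail: Summit-strength: with PiPowDegree it yields "π² is not the value of a rational 1-dim representation" (open transcendence), and its k = 0 layer says every rational rep with an algebraic value moves to a point — accessibility no engine here proves.
sources: KontsevichZagierPeriods2001, Wan2011, HuberWustholz2022, HuberMullerStachPeriods2017
[crux] OPEN CORE 1 (compression half of Conjecture 1): if two rational integral representations have
the same value, every dimension reachable by moves from one is reachable from the other — equal
values ⇒ equal KZ-degree; in particular every rational representation of a number that has a
k-dimensional representation compresses to k variables. Under DegreeBound + DegreeEquality it reads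
"equal values ⇒ equal Hodge co-level", a one-integer shadow of the formal period conjecture.
[difficulty: open-problem] -/
@[route_item "route-KontsevichZagierPeriods-HodgeColevel", crux]
def DegreeCompression : Prop :=
  ∀ ⦃n m : ℕ⦄ (r : Literature.NumberTheory.Transcendental.KZ.IntegralRep n) (r' : Literature.NumberTheory.Transcendental.KZ.IntegralRep m), r.IsRational → r'.IsRational → r.value = r'.value → ∀ (k : ℕ), (∃ s : Literature.NumberTheory.Transcendental.KZ.IntegralRep k, Literature.NumberTheory.Transcendental.KZ.Equivalent r s) → ∃ s' : Literature.NumberTheory.Transcendental.KZ.IntegralRep k, Literature.NumberTheory.Transcendental.KZ.Equivalent r' s'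

/-- item stmt-KontsevichZagierPeriods-6178 · crux · rank 5 · open · by planner
why it might fail: Summit-strength: at d = w it contains all weight-w MZV identities with regularised intermediates and the Γ-detour identities (route Neg pressure points (a),(b)); a non-equivalent incompressible pair of equal value refutes it and the summit together.
sources: KontsevichZagierPeriods2001, HuberMullerStachPeriods2017, CressonViusos2022, HuberWustholz2022
[crux] OPEN CORE 2 (same-degree half of Conjecture 1): two integral representations of the same
dimension d, both incompressible (not KZ-equivalent to any representation of dimension < d), with
the same value, are KZ-equivalent. Graded by one integer: d = 1 is SameDegreeOne (support;
Huber–Wüstholz sector), d = 2 already contains Euler's ζ(2) = π²/6, Catalan-type and elliptic area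
identities, d = w the weight-w MZV relations. DegreeBound instances certify the incompressibility
hypotheses of concrete pairs. [difficulty: open-problem] -/
@[route_item "route-KontsevichZagierPeriods-HodgeColevel", crux]
def SameDegreeConjecture : Prop :=
  ∀ (d : ℕ) (r r' : Literature.NumberTheory.Transcendental.KZ.IntegralRep d), (∀ k < d, ∀ s : Literature.NumberTheory.Transcendental.KZ.IntegralRep k, ¬ Literature.NumberTheory.Transcendental.KZ.Equivalent r s) → (∀ k < d, ∀ s : Literature.NumberTheory.Transcendental.KZ.IntegralRep k, ¬ Literature.NumberTheory.Transcendental.KZ.Equivalent r' s) → r.value = r'.value → Literature.NumberTheory.Transcendental.KZ.Equivalent r r'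

-- item stmt-KontsevichZagierPeriods-6960 · crux (kind.auto-crux: conjecture-grade) · rank 7 · open · by planner — informal only, no Lean statement yet:
--   [crux] DegreeEquality — the card's converse CONJECTURE (untyped until D1–D3 land): for every
--   integral representation r, deg_KZ(r) = L(Ψ[r]) (equality in DegreeBound), i.e. every symbol whose
--   generated comodule has all Hodge types in the box [0,L]² is KZ-equivalent to an L-dimensional
--   representation; equivalently the moves realise every compression that Hodge theory allows — an
--   EFFECTIVITY statement of generalized-Hodge-conjecture type (a sub-Hodge-structure of small type box
--   is carried by a pair of small dimension, one variable per Tate twist), and, under Conjecture 1,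
--   Wan's value-degree equal

/-- item stmt-KontsevichZagierPeriods-6182 · crux (kind.auto-crux: conjecture-grade) · rank 9 · open · by planner
why it might fail: auto-crux — conjecture-grade statement (docstring avows it ('Conjecture')); it is open, so it may simply be false
sources: HuberWustholz2022, KontsevichZagierPeriods2001, Baker1975
[support] the first rung of SameDegreeConjecture (d = 1): two 1-dimensional integral
representations, neither KZ-equivalent to a constant, with the same value are KZ-equivalent. Values
of 1-dim semialgebraic reps are cohomological 1-periods (curves relative points); HuberWustholz2022
Thm 13.3 (Kontsevich's period conjecture for 𝒫¹: all ℚ̄-linear relations are induced by bilinearity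
and functoriality of curve pairs) plus a dimension-1 transfer of functoriality along finite maps of
curves into moves (monotone branches = changes of variables; several sheets = route MultivaluedCoV's
SheetTransfer at n = 1). Complements route LowDimension (rational reps, Baker) on semialgebraic
reps. [difficulty: XL] -/
@[route_item "route-KontsevichZagierPeriods-HodgeColevel"]
def SameDegreeOne : Prop :=
  ∀ (r r' : Literature.NumberTheory.Transcendental.KZ.IntegralRep 1), (∀ s : Literature.NumberTheory.Transcendental.KZ.IntegralRep 0, ¬ Literature.NumberTheory.Transcendental.KZ.Equivalent r s) → (∀ s : Literature.NumberTheory.Transcendental.KZ.IntegralRep 0, ¬ Literature.NumberTheory.Transcendental.KZ.Equivalent r' s) → r.value = r'.value → Literature.NumberTheory.Transcendental.KZ.Equivalent r r'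

-- item stmt-KontsevichZagierPeriods-6951 · support · rank 6 · open · by planner — informal only, no Lean statement yet:
--   [crux] DegreeBound — the general schema of card kz-degree-hodge-colevel-problem-two (untyped until
--   definition requests D2 KZ.noriSymbol (Ψ) and D3 HodgeColevelFiltration land): for every integral
--   representation r of dimension n, deg_KZ(r) ≥ L(Ψ[r]), where Ψ : KZ.FormalRep →+ P̃(ℚ) is the Nori
--   formal-period symbol of a representation ("moves are motivic": additive, vanishing on KZ.relations,
--   ev ∘ Ψ = KZ.eval, Ψ[of r] ∈ C(H^n of an n-dimensional pair)) and L(x) := least k with x ∈ C_k P̃ :=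
--   Σ{ C(V) : V a Nori motive all of whose Hodge types (p,q) have max(p,q) ≤ k } (coefficient spaces);
--   weight

/-- item stmt-KontsevichZagierPeriods-14209 · support · rank 9 · closed · proved by Summit.KontsevichZagierPeriods.HodgeColevel.targetOfCores_proof @ 41111289aa13 (prover) · by planner
[support] glue (route-choice hold 2026-08-16, option (a): make the target reachable from the
cruxes): the two open cores DegreeCompression (crux, rank 4) and SameDegreeConjecture (crux, rank 5)
assemble the target X — Target is literally their conjunction, so the proof is `fun hC hS => ⟨hC,
hS⟩` (checked sorry-free in the planner Sketch.lean, lean check rc 0). Provable now; difficulty: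
trivial. Sources: KontsevichZagierPeriods2001 (§1.2 Conjecture 1, Problem 2). -/
@[route_item "route-KontsevichZagierPeriods-HodgeColevel"]
def TargetOfCores : Prop :=
  DegreeCompression → SameDegreeConjecture → Target

/-- item stmt-KontsevichZagierPeriods-6179 · support · rank 9 · open · by planner
sources: KontsevichZagierPeriods2001, Wan2011, HuberMullerStachPeriods2017
[support] π² needs two variables (n = 2 of PiPowDegree, the crisp first Lean target of the engine):
the representation [ (0,1)², 16/((1+x²)(1+y²)) ] is not KZ-equivalent to any 1-dimensional integral
representation. Consistent with Wan2011 Ex. 3.3(2) (π² as a 2-dim rep with rational integrand over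
the disc) and with Euler ζ(2) = π²/6 (both sides of degree 2). [difficulty: L] -/
@[route_item "route-KontsevichZagierPeriods-HodgeColevel", crux]
def PiSquaredDegree : Prop :=
  ∀ (r : Literature.NumberTheory.Transcendental.KZ.IntegralRep 2), r.domain = {z | z 0 ∈ Set.Ioo (0:ℝ) 1 ∧ z 1 ∈ Set.Ioo (0:ℝ) 1} → Set.EqOn r.integrand (fun z => 16 / ((1 + z 0 ^ 2) * (1 + z 1 ^ 2))) r.domain → ∀ (r' : Literature.NumberTheory.Transcendental.KZ.IntegralRep 1), ¬ Literature.NumberTheory.Transcendental.KZ.Equivalent r r'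

/-- item stmt-KontsevichZagierPeriods-6180 · support · rank 9 · closed · proved by Summit.KontsevichZagierPeriods.HodgeColevel.PiPowNotConstant.piPowNotConstant_proof @ c89b88cc1788 (prover) · by planner
sources: KontsevichZagierPeriods2001, Lindemann1882
[support] provable now (calibration of the 0-dimensional API and the m = 0 slice of PiPowDegree):
for n ≥ 1 the cube representation of π^n is not KZ-equivalent to any 0-dimensional representation —
soundness KZ.Equivalent.value_eq_holds, the value of a 0-dim rep is a real algebraic number (a
ℚ-semialgebraic point of ℝ), Fubini + ∫₀¹ 4/(1+x²) = π, and Lindemann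
(Literature.NumberTheory.Transcendental.transcendental_pi_holds). [difficulty: provable-now] -/
@[route_item "route-KontsevichZagierPeriods-HodgeColevel"]
def PiPowNotConstant : Prop :=
  ∀ (n : ℕ), 1 ≤ n → ∀ (r : Literature.NumberTheory.Transcendental.KZ.IntegralRep n), r.domain = {z | ∀ i, z i ∈ Set.Ioo (0:ℝ) 1} → Set.EqOn r.integrand (fun z => ∏ i, 4 / (1 + z i ^ 2)) r.domain → ∀ (r' : Literature.NumberTheory.Transcendental.KZ.IntegralRep 0), ¬ Literature.NumberTheory.Transcendental.KZ.Equivalent r r'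

/-- item stmt-KontsevichZagierPeriods-6181 · support · rank 9 · open · by planner
sources: HuberMullerStachPeriods2017, Andre2004, HuberWustholz2022, DeligneHodgeII1971
[support] Hodge TYPE is finer than weight (card's F-separator, on a PURE symbol with no support
subtlety): the square of the real period ∫₁^∞ dx/√(x³−x) of y² = x³ − x, written as the 2-dim
representation [ (1,∞)², 1/√((x³−x)(y³−y)) ], is not KZ-equivalent to any 1-dimensional
representation — its symbol is the square of a weight-1 symbol (the relative part vanishes by the
[−1]-symmetry), of Hodge type (2,0)+…, outside the box [0,1]² of curve pairs, although its weight 2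
alone would allow one variable. [difficulty: XL] -/
@[route_item "route-KontsevichZagierPeriods-HodgeColevel"]
def EllipticSquareDegree : Prop :=
  ∀ (r : Literature.NumberTheory.Transcendental.KZ.IntegralRep 2), r.domain = {z | 1 < z 0 ∧ 1 < z 1} → Set.EqOn r.integrand (fun z => 1 / Real.sqrt ((z 0 ^ 3 - z 0) * (z 1 ^ 3 - z 1))) r.domain → ∀ (r' : Literature.NumberTheory.Transcendental.KZ.IntegralRep 1), ¬ Literature.NumberTheory.Transcendental.KZ.Equivalent r r'

/-- item stmt-KontsevichZagierPeriods-6183 · support · rank 9 · closed · proved by Summit.KontsevichZagierPeriods.HodgeColevel.coresOfSummit_proof @ 41111289aa13 (prover) · by planner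
sources: KontsevichZagierPeriods2001
[support] honesty certificate, provable now (proved in the planner's Sketch.lean): the summit
implies both open cores — DegreeCompression by symmetry/transitivity of KZ.Equivalent,
SameDegreeConjecture via the semialgebraic two-representation form
(Literature.NumberTheory.Transcendental.kzPeriodConjecture'_iff_isRational). Hence a refutation of
either core refutes Conjecture 1 (hand the witness to route Neg). [difficulty: provable-now] -/
@[route_item "route-KontsevichZagierPeriods-HodgeColevel"]
def CoresOfSummit : Prop :=
  KontsevichZagierPeriods → DegreeCompression ∧ SameDegreeConjecture

/-- item stmt-KontsevichZagierPeriods-6184 · assembly · rank 1 · closed · proved by Summit.KontsevichZagierPeriods.HodgeColevel.assembly_proof @ 7343233001e8 (prover) · by planner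
sources: KontsevichZagierPeriods2001
[assembly] DegreeCompression → SameDegreeConjecture → KontsevichZagierPeriods. -/
@[route_item "route-KontsevichZagierPeriods-HodgeColevel"]
def Assembly : Prop :=
  DegreeCompression → SameDegreeConjecture → KontsevichZagierPeriods

/-! D-0027 §2.1 — DECIDING THEOREM (planner-authored via `route open/edit --closes-file`; by planner-rbadge-KontsevichZagierPeriods-HodgeCo-2219d486-g2-0 2026-08-15T16:19:13Z):
its hypotheses are this route's items and its conclusion the sub-problem Statement (glue_lint), and it elaborates with this file. -/

@[closes "route-KontsevichZagierPeriods-HodgeColevel"] theorem closes (hC : DegreeCompression) (hS : SameDegreeConjecture) : KontsevichZagierPeriods := by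
  classical
  intro n m r r' hr hr' hv
  -- the dimensions reachable from `r` by moves; `Nat.find hex` is the KZ-degree of `r`
  have hex : ∃ k, ∃ s : Literature.NumberTheory.Transcendental.KZ.IntegralRep k,
      Literature.NumberTheory.Transcendental.KZ.Equivalent r s :=
    ⟨n, r, Literature.NumberTheory.Transcendental.KZ.Equivalent.refl r⟩
  obtain ⟨s, hs⟩ := Nat.find_spec hex
  have hmin : ∀ k < Nat.find hex, ∀ t : Literature.NumberTheory.Transcendental.KZ.IntegralRep k,
      ¬ Literature.NumberTheory.Transcendental.KZ.Equivalent r t :=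
    fun k hk t ht => Nat.find_min hex hk ⟨t, ht⟩
  -- compression: `r'` reaches the KZ-degree of `r`
  obtain ⟨s', hs'⟩ := hC r r' hr hr' hv (Nat.find hex) ⟨s, hs⟩
  -- both minimal-dimension representatives are incompressible
  have hsinc : ∀ k < Nat.find hex, ∀ t : Literature.NumberTheory.Transcendental.KZ.IntegralRep k,
      ¬ Literature.NumberTheory.Transcendental.KZ.Equivalent s t :=
    fun k hk t ht => hmin k hk t (hs.trans ht)
  have hs'inc : ∀ k < Nat.find hex, ∀ t : Literature.NumberTheory.Transcendental.KZ.IntegralRep k,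
      ¬ Literature.NumberTheory.Transcendental.KZ.Equivalent s' t := by
    intro k hk t ht
    obtain ⟨t', ht'⟩ := hC r' r hr' hr hv.symm k ⟨t, hs'.trans ht⟩
    exact hmin k hk t' ht'
  -- soundness of the moves: they have the same value
  have h1 : r.value = s.value :=
    Literature.NumberTheory.Transcendental.KZ.Equivalent.value_eq_holds hs
  have h2 : r'.value = s'.value :=
    Literature.NumberTheory.Transcendental.KZ.Equivalent.value_eq_holds hs'
  have hval : s.value = s'.value := by rw [← h1, ← h2, hv]
  -- same-degree half, then chain r ~ s ~ s' ~ r'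
  exact hs.trans ((hS (Nat.find hex) s s' hsinc hs'inc hval).trans hs'.symm)

end Summit.KontsevichZagierPeriods.KontsevichZagierPeriods.Theses.HodgeColevel
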